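import Mathlib

/-! # RankLevelSetFlatExcessModelNeg — THE FLAT-EXCESS RULE'S TYPE RECEIPT ON THE MODEL FAMILY IS BELOW THE DEMAND
(night-1 g23, attempt 2; dossier §35.8 (the arithmetic item (FX-model)) and §35.9 (its refutation); NEGATIVE)

The MODEL family `T_{q+k}(U_{q,F} ⊕ free D)` of the cell's C-044 work: `#F = q + m`, `#D = u + k`, `u = q − m`,
rank `p = q + k`, `n = 2q + k` (the tight layer). At the rank level `t = q + s` (`1 ≤ s ≤ k − 1`) a member `Z` of TYPE
`j = #(Z ∩ D)` receives, under the FLAT-EXCESS split of `RankLevelSetHallLevelSplit` (`flatExcessW`: a rank-`t` set `S`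
with `#(S ∩ F) = q + a'`, `a' ≥ 1`, gives its members weight `(a' + 1)^{#(Z' ∩ F)}`; a thin set the equal split), the
closed-form receipt of §35.8, re-indexed by `a₁ = #(X ∩ F)` for the thin sets `S = Z ∪ X`:

  thin(j) = Σ_{a₁ ≤ min(j,s)} C(m+j, a₁)·C(u+k−j, s−a₁) / Σ_{j' ≤ min(u, j+s−a₁)} C(q−j+a₁, q−j')·C(j+s−a₁, j')
  fat(j)  = [j ≤ s]·C(u+k−j, s−j)·Σ_{a'=1}^{m} C(m+j, a'+j)·(a'+1)^{q−j} / Σ_{j' ≤ min(u,s)} C(q+a', q−j')·C(s, j')·(a'+1)^{q−j'}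

against the demand `C(q+k, s)/C(q+s, s)` (= `C(n,t)/C(n,q)`). The arithmetic item (FX-model) of §35.8 asserted
`thin(j) + fat(j) ≥ demand` for all `q, k, m, s, j`; it is FALSE: at `(q,k,m,s) = (11,9,1,8)` (the TOP level of the
cell `(20, 11)`, `n = 31`) the type `j = 5` receives `271272580255351681/162768704720711760 = 1.66661…` against the
demand `5/3` (ratio `0.9999683…`), and at `(16,10,5,9)` the type `j = 6` receives ratio `0.99922…`. These are the
two minima of kit j298334 (the model `q ≤ 150`, `k ≤ 10`, all `m`, all levels, 504,812 instances: 44 failures, all at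
the top level `s = k − 1`, `q ∈ [11, 22]`); the twin of this file is `mining/night-1/g23/fxfail.py` (exact Fractions,
type receipts by `rules_model.py`), which agrees with the formula on every type of every instance checked.

What this file does NOT claim: the identification of the formula with `splitRecvLevel M (flatExcessW M q) p q t Z`
on the model matroid (the matroid half — the type count of the members inside a set and of the sets above a member)
is the paper computation of §35.8, not a theorem here; the theorems below are the arithmetic only. With that
identification, `FlatExcessC025` (a `Prop` of `RankLevelSetHallLevelSplit`, never asserted) is false; nothing landed
depends on it (`hallUp_level_of_split` holds for any positive rule). Mathlib only; every declaration has a docstring. -/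

namespace PercRepro

/-- **The thin part of the flat-excess type receipt on the model**: the equal-split receipt of a member of type `j`
from the rank-`(q+s)` sets `Z ∪ X` with `#(X ∩ F) = a₁ ≤ min(j, s)` (`#(S ∩ F) = q − j + a₁ ≤ q`), each containing
`Σ_{j' ≤ min(u, j+s−a₁)} C(q−j+a₁, q−j')·C(j+s−a₁, j')` members (`u = q − m`). -/
def fxThinModel (q k m s j : ℕ) : ℚ :=
  ∑ a₁ ∈ Finset.range (min j s + 1),
    (((m + j).choose a₁ * (q - m + k - j).choose (s - a₁) : ℕ) : ℚ) /
      ∑ j' ∈ Finset.range (min (q - m) (j + s - a₁) + 1),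
        (((q - j + a₁).choose (q - j') * (j + s - a₁).choose j' : ℕ) : ℚ)

/-- **The fat part of the flat-excess type receipt on the model**: for `j ≤ s`, the `C(u+k−j, s−j)·C(m+j, a'+j)` fat
sets of excess `a'` above a member of type `j` each give it `(a'+1)^{q−j} / Σ_{j' ≤ min(u,s)} C(q+a', q−j')·C(s, j')·(a'+1)^{q−j'}`;
for `j > s` there is no fat set above the member. (The excess `a' = i + 1` runs over `i ∈ range m`.) -/
def fxFatModel (q k m s j : ℕ) : ℚ :=
  if j ≤ s then
    (((q - m + k - j).choose (s - j) : ℕ) : ℚ) *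
      ∑ i ∈ Finset.range m,
        (((m + j).choose (i + 1 + j) * (i + 2) ^ (q - j) : ℕ) : ℚ) /
          ∑ j' ∈ Finset.range (min (q - m) s + 1),
            (((q + (i + 1)).choose (q - j') * s.choose j' * (i + 2) ^ (q - j') : ℕ) : ℚ)
  else 0

/-- **The flat-excess type receipt on the model** (§35.8): thin part plus fat part. -/
def fxRecvModel (q k m s j : ℕ) : ℚ := fxThinModel q k m s j + fxFatModel q k m s j

/-- **The demand at the level `s` of the cell `(q+k, q)`**: `C(q+k, s)/C(q+s, s) = C(n, t)/C(n, q)` with `n = 2q+k`,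
`t = q+s`. -/
def levelDemand (q k s : ℕ) : ℚ := ((q + k).choose s : ℚ) / ((q + s).choose s : ℚ)

/-- The demand at `(q,k,s) = (11,9,8)` is `5/3`. -/
lemma levelDemand_11_9_8 : levelDemand 11 9 8 = 5 / 3 := by
  unfold levelDemand
  norm_num [Nat.choose]

/-- **THE FLAT-EXCESS RULE FAILS ON THE MODEL (kernel-checked arithmetic)**: at `(q,k,m,s) = (11,9,1,8)` — the top
level of the cell `(20,11)` on `31` elements, `#F = 12`, `#D = 19` — the member type `j = 5` (`6` elements in `F`,
`5` in `D`) receives `271272580255351681/162768704720711760 < 5/3`. Hence the arithmetic item (FX-model) of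
§35.8 is false. -/
theorem fxRecvModel_11_9_1_8_5_lt_demand : fxRecvModel 11 9 1 8 5 < levelDemand 11 9 8 := by
  rw [levelDemand_11_9_8]
  unfold fxRecvModel fxThinModel fxFatModel
  simp only [show min 5 8 = 5 from rfl, show (11 : ℕ) - 1 = 10 from rfl, show min 10 8 = 8 from rfl,
    Finset.sum_range_succ, Finset.sum_range_zero]
  norm_num [Finset.sum_range_succ, Nat.choose]

/-- The exact value of the failing receipt at `(11,9,1,8)`, type `5`. -/
theorem fxRecvModel_11_9_1_8_5_eq :
    fxRecvModel 11 9 1 8 5 = 271272580255351681 / 162768704720711760 := by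
  unfold fxRecvModel fxThinModel fxFatModel
  simp only [show min 5 8 = 5 from rfl, show (11 : ℕ) - 1 = 10 from rfl, show min 10 8 = 8 from rfl,
    Finset.sum_range_succ, Finset.sum_range_zero]
  norm_num [Finset.sum_range_succ, Nat.choose]

/-- **The second minimum of kit j298334**: at `(q,k,m,s) = (16,10,5,9)` (the top level of the cell `(26,16)`,
`n = 42`) the type `j = 6` receives less than the demand `C(26,9)/C(25,9) = 26/17`. -/
theorem fxRecvModel_16_10_5_9_6_lt_demand : fxRecvModel 16 10 5 9 6 < levelDemand 16 10 9 := by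
  unfold fxRecvModel fxThinModel fxFatModel levelDemand
  simp only [show min 6 9 = 6 from rfl, show (16 : ℕ) - 5 = 11 from rfl, show min 11 9 = 9 from rfl,
    Finset.sum_range_succ, Finset.sum_range_zero]
  norm_num [Finset.sum_range_succ, Nat.choose]

end PercRepro
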